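import Summits.Ventures.Crystal3D.Theorems.StickyWulffConstantCoaxialWallLawThinWallRate
import Summits.Ventures.Crystal3D.Theorems.StickyWulffConstantCoaxialWallLawForeignTilt
import HarnessLib

/-!
# The thin-wall law on the whole vicinal-to-steep range `tan θ < √8`

HONEST FRAMING. Part of the venture `Summits/Ventures/Crystal3D` (cell `crystal3d-full`), helper
`--supports` the crux `CoaxialWallLaw` (stmt-Ventures-19481, `route-Ventures-StickyWulffConstant`),
REGISTERED line `WallLedgerF` (planner cf-p1 gen 16), stub `stub_coaxialTwoSlabAdhesion`.  Assembly of
`coaxialTwoSlabAdhesion_thinWall_of_rate` (`…ThinWallRate`) with the sharp foreign-plate tilt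
`foreign_descent_rate_of_coaxial` (`…ForeignTilt`).  Inputs `KissingGap δ`, `KissingClassification δ` BY NAME
only (tree theorems at `δ = 5/2`, computational grade).  Rung credit only; F-C1 not moved.

**Theorem (`coaxialTwoSlabAdhesion_thinWall_all`).**  `Λ₁ = A₁·Λ₀ + t₁` co-axial with the frame `L` (the crux
hypothesis for grain 1), `Λ₂ ≠ Λ₁` ANY second grain, and the shared axis `m = L e₃` in the range

  `sin θ < √8 · cos θ`, i.e. `tan θ < √8`, `θ = ∠(e₃, m) < arccos(1/3) = 70.53°`

(`sin θ = √(1 − ⟪m, e₃⟫²)`, `cos θ = |⟪m, e₃⟫|`) — every inclination except those at which a FOREIGN `{111}` plane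
of grain 1 (at `70.53°` from `m`) can be horizontal.  Then there are `C` and `R₀ = 10` such that in EVERY cell of
`CoaxialTwoSlabAdhesion` (ARBITRARY unit-separated filling; nothing else assumed):

  `cross(P₁, X∖P₁) + cross(P₂, Y) ≤ D(Y) + (φ₁ + φ₂ − sin θ · δ(θ) / (80000 (1 + h))) π ρ² + C (1 + h) ρ`,
  `δ(θ) = (√3/6)(√8 cos θ − sin θ) > 0`.

NO residual, NO certificate: every wall of thickness `h` between a co-axial grain with `tan θ < √8` and any other
grain costs at least `sin θ · δ(θ) · πρ² / (80000 (1 + h))` beyond the two outer faces, whatever the filling.  The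
previous thin-wall law (`coaxialTwoSlabAdhesion_thinWall`, 19481-p1 g4) covered `sin θ ≤ 2/5` only.  Reading: a
counterexample family to the stub (charge `½ sin θ`, `h`-uniform) must use structures of UNBOUNDED HEIGHT at every
inclination `θ < 70.53°`; the complementary range (shared axis `≥ 70.53°` off the cell axis: basal planes nearly
edge-on, one foreign `{111}` family nearly horizontal) is the prism-zone geometry of cf-p1's row-ledger programme.

WHAT THIS IS NOT: not the stub (charge `∝ 1/(1+h)`); nothing for `tan θ ≥ √8`; F-C1 not moved.
-/

noncomputable section

namespace Summit.Ventures.Crystal3D.Theorems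

open Summit.Ventures.Crystal3D Finset
open Literature.MathematicalPhysics.StatisticalMechanics (fccStacking barlowStacking IsHaggSeq contactDeficiency)
open scoped InnerProductSpace

/-- `(√3/6)(√8·|c| − s) ≤ 1` whenever `|c| ≤ 1` and `0 ≤ s`. -/
theorem foreignRate_le_one {c s : ℝ} (hc : |c| ≤ 1) (hs : 0 ≤ s) :
    Real.sqrt 3 / 6 * (Real.sqrt 8 * |c| - s) ≤ 1 := by
  have h3 : Real.sqrt 3 ≤ 2 := by
    rw [show (2 : ℝ) = Real.sqrt (2 ^ 2) by rw [Real.sqrt_sq (by norm_num)]]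
    exact Real.sqrt_le_sqrt (by norm_num)
  have h8 : Real.sqrt 8 ≤ 3 := by
    rw [show (3 : ℝ) = Real.sqrt (3 ^ 2) by rw [Real.sqrt_sq (by norm_num)]]
    exact Real.sqrt_le_sqrt (by norm_num)
  have h30 : 0 ≤ Real.sqrt 3 := Real.sqrt_nonneg 3
  have h80 : 0 ≤ Real.sqrt 8 := Real.sqrt_nonneg 8
  have h1 : Real.sqrt 8 * |c| - s ≤ 3 := by nlinarith [abs_nonneg c]
  nlinarith

open scoped Classical in
/-- **The thin-wall law for every inclination with `tan θ < √8`.**  See the module docstring. -/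
theorem coaxialTwoSlabAdhesion_thinWall_all {δ : ℝ} (hg : KissingGap δ) (hc : KissingClassification δ)
    (A₁ : EuclideanSpace ℝ (Fin 3) ≃ₗᵢ[ℝ] EuclideanSpace ℝ (Fin 3)) (t₁ : EuclideanSpace ℝ (Fin 3))
    (A₂ : EuclideanSpace ℝ (Fin 3) ≃ₗᵢ[ℝ] EuclideanSpace ℝ (Fin 3)) (t₂ : EuclideanSpace ℝ (Fin 3))
    (L : EuclideanSpace ℝ (Fin 3) ≃ₗᵢ[ℝ] EuclideanSpace ℝ (Fin 3)) (s₁ : EuclideanSpace ℝ (Fin 3))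
    {σ : ℤ → ℤ} (hσ : IsHaggSeq σ)
    (hsub₁ : (fun p => A₁ p + t₁) '' fccStacking 1 (Real.sqrt (2 / 3)) ⊆
      (fun p => L p + s₁) '' barlowStacking 1 (Real.sqrt (2 / 3)) σ)
    (hne : (fun p => A₁ p + t₁) '' fccStacking 1 (Real.sqrt (2 / 3)) ≠
      (fun p => A₂ p + t₂) '' fccStacking 1 (Real.sqrt (2 / 3)))
    (hreg : Real.sqrt (1 - ⟪L (EuclideanSpace.single (2 : Fin 3) (1 : ℝ)),
        EuclideanSpace.single (2 : Fin 3) (1 : ℝ)⟫_ℝ ^ 2) <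
      Real.sqrt 8 * |⟪L (EuclideanSpace.single (2 : Fin 3) (1 : ℝ)), EuclideanSpace.single (2 : Fin 3) (1 : ℝ)⟫_ℝ|) :
    ∃ C R₀ : ℝ, 1 ≤ R₀ ∧ ∀ h : ℝ, 0 ≤ h → ∀ ρ : ℝ, R₀ ≤ ρ →
      ∀ X P₁ P₂ : Finset (EuclideanSpace ℝ (Fin 3)),
      (∀ p ∈ X, ∀ q ∈ X, p ≠ q → 1 ≤ dist p q) → P₁ ⊆ X → P₂ ⊆ X \ P₁ →
      (∀ p ∈ X, -(2 * R₀) ≤ p 2 ∧ p 2 ≤ h + 2 * R₀ ∧ p 0 ^ 2 + p 1 ^ 2 ≤ ρ ^ 2) →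
      (∀ p, p ∈ P₁ ↔ (p ∈ (fun q => A₁ q + t₁) '' fccStacking 1 (Real.sqrt (2 / 3)) ∧
        -(2 * R₀) ≤ p 2 ∧ p 2 ≤ -R₀ ∧ p 0 ^ 2 + p 1 ^ 2 ≤ ρ ^ 2)) →
      (∀ p, p ∈ P₂ ↔ (p ∈ (fun q => A₂ q + t₂) '' fccStacking 1 (Real.sqrt (2 / 3)) ∧
        h + R₀ ≤ p 2 ∧ p 2 ≤ h + 2 * R₀ ∧ p 0 ^ 2 + p 1 ^ 2 ≤ ρ ^ 2)) →
      ((((P₁ ×ˢ (X \ P₁)).filter fun pq => dist pq.1 pq.2 = 1).card : ℕ) : ℝ) +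
        ((((P₂ ×ˢ ((X \ P₁) \ P₂)).filter fun pq => dist pq.1 pq.2 = 1).card : ℕ) : ℝ) ≤
        contactDeficiency ((X \ P₁) \ P₂) +
          (Real.sqrt 2 / 4 * ∑ᶠ w ∈ {w ∈ fccStacking 1 (Real.sqrt (2 / 3)) | ‖w‖ = 1},
              |⟪w, A₁.symm (EuclideanSpace.single (2 : Fin 3) (1 : ℝ))⟫_ℝ| +
            Real.sqrt 2 / 4 * ∑ᶠ w ∈ {w ∈ fccStacking 1 (Real.sqrt (2 / 3)) | ‖w‖ = 1},
              |⟪w, A₂.symm (EuclideanSpace.single (2 : Fin 3) (1 : ℝ))⟫_ℝ| -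
            Real.sqrt (1 - ⟪L (EuclideanSpace.single (2 : Fin 3) (1 : ℝ)),
              EuclideanSpace.single (2 : Fin 3) (1 : ℝ)⟫_ℝ ^ 2) *
              (Real.sqrt 3 / 6 * (Real.sqrt 8 * |⟪L (EuclideanSpace.single (2 : Fin 3) (1 : ℝ)),
                  EuclideanSpace.single (2 : Fin 3) (1 : ℝ)⟫_ℝ| -
                Real.sqrt (1 - ⟪L (EuclideanSpace.single (2 : Fin 3) (1 : ℝ)),
                  EuclideanSpace.single (2 : Fin 3) (1 : ℝ)⟫_ℝ ^ 2))) / (80000 * (1 + h))) * Real.pi * ρ ^ 2 +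
          C * (1 + h) * ρ := by
  set e₃ : EuclideanSpace ℝ (Fin 3) := EuclideanSpace.single (2 : Fin 3) (1 : ℝ) with he₃
  have hLe₃ : ‖L e₃‖ = 1 := by rw [LinearIsometryEquiv.norm_map, he₃, PiLp.norm_single, norm_one]
  have hc1 : |⟪L e₃, e₃⟫_ℝ| ≤ 1 := by
    have := abs_real_inner_le_norm (L e₃) e₃
    rwa [hLe₃, show ‖e₃‖ = 1 by rw [he₃, PiLp.norm_single, norm_one], one_mul] at this
  have hδ₀ : 0 < Real.sqrt 3 / 6 * (Real.sqrt 8 * |⟪L e₃, e₃⟫_ℝ| - Real.sqrt (1 - ⟪L e₃, e₃⟫_ℝ ^ 2)) := by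
    have h30 : 0 < Real.sqrt 3 := Real.sqrt_pos.2 (by norm_num)
    have : 0 < Real.sqrt 8 * |⟪L e₃, e₃⟫_ℝ| - Real.sqrt (1 - ⟪L e₃, e₃⟫_ℝ ^ 2) := by linarith
    positivity
  have hδ₁ := foreignRate_le_one hc1 (Real.sqrt_nonneg (1 - ⟪L e₃, e₃⟫_ℝ ^ 2))
  exact coaxialTwoSlabAdhesion_thinWall_of_rate hg hc A₁ t₁ A₂ t₂ L s₁ hσ hsub₁ hne hδ₀ hδ₁
    (fun n hn hmenu hnL hnL' => foreign_descent_rate_of_coaxial A₁ t₁ L s₁ σ hsub₁ hn hmenu hnL hnL')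

end Summit.Ventures.Crystal3D.Theorems

end
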